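import Summits.BirchSwinnertonDyer.BirchSwinnertonDyer.Theorems.PrintCf2RamifiedOffTYZEvenOmegaRowFour
import HarnessLib

/-!
# Route `PrintCf2`, crux stmt-BirchSwinnertonDyer-20509 `RamifiedOffTYZOfFacts` — THE EVEN Ω-IDENTITY, ROW (iii) (`x_im x_j`), ABSTRACT FOREST FORM
# (cell `bsd-print-cf2`, LEAD of 20509 g14, line `offtyz-v7`, cycle 15; kernel helpers `--supports stmt-BirchSwinnertonDyer-20509`)

Row (iii) of LEAD g13's research statement `EvenOmegaMatrixIdentity` (crux workfile `Cruxes/RamifiedOffTYZOfFacts/Lines/offtyz_v7_EvenOmega.lean`;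
proof `Lines/offtyz_v7_EvenOmegaProof.md` §6, LEAD g14), in the abstract vocabulary of the tree's bipartite forest formula and of the convolution
calculus `…QFormConvolution` (reciprocity law `a s t + a t s = y_s y_t` on all of `V`, second vector `z`, vertex set `D` with `Σ_D y = 1`;
`Y = setExp(q_y)`, `F = setExp(fwt a y z z)`, `W′ = setExp(fwt a y z 0)`, `E = setExp(q_{y+z})`, `f_o = fwt a y z 0`, `f_e = fwt a y z z`).
For a pointing vector `x` (the `x_im x_j`-row of the even square form, summed against `x_j`, read through the forest dictionary of §1 of the
workfile, and the corresponding part `Σ_j x_j (A_j + A′_j + G)` of the even Ω-form):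

  **(iii)**  `((p_y((p_x q_z) ⋆ E)) ⋆ W′)(D) + ((p_z(q_x ⋆ Y)) ⋆ (f_o ⋆ F))(D) = ((p_y q_x) ⋆ F)(D) + ((p_x q_z) ⋆ F)(D) + (Σ_D x)·(Y ⋆ F)(D)`

for unit vectors `x = e_r` (`row_three_identity`).  Proof: Leibniz expansions (§2) and the dictionary (`E ⋆ W′ = Y ⋆ F`, `p_y Y = Y + δ`,
`p_z Y = f_o`, pointed reciprocity `p_x Y = p_y q_x`, `f_o ⋆ f_o = 0`) reduce (iii) to `(((p_x q_z) + (p_z q_x)) ⋆ Y ⋆ f_o ⋆ F)(D) = 0` (§3); there an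
odd first block carries `(p_x q_z + p_z q_x) = 0` (flatness) and an even one carries `(p_x q_z + p_z q_x) = q_x ⋆ f_o` (§1: the tree's pinned expansion
`pinned_expansion_eq` and `adj(L_C + D_y)_{rr} = κ_r(C) + q_y(C)`, `adjugate_lap_self_eq`), after which `f_o ⋆ f_o = 0`.
Pure linear algebra / finite combinatorics over `𝔽₂`; no number theory, no `sorry`.  BSD is not proved by any of this; no class is closed.

References: [cite: Chaiken1982, §2]; [cite: Stanley1999EC2, Cor. 5.1.6]; [cite: Smith2016CongruentDensity, §2.2 case 5(b)]; [cite: ChebotarevAgaev2002, §3 Thm. 2];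
[cite: HeathBrown1994SelmerCongruentII, Appendix (Monsky), typescript p. 41 L20–L36]; crux notes `Lines/offtyz_v7_EvenOmegaProof.md` §6.
-/

namespace Summit.BirchSwinnertonDyer.PrintCf2.QFormForest

open Matrix Finset Literature.LinearAlgebra.Matrix Literature.Combinatorics.Enumerative
open Literature.NumberTheory.EllipticCurves.Smith2016

variable {V : Type*} [Fintype V] [LinearOrder V]

section RowThree

variable (a : V → V → ZMod 2) (y z : V → ZMod 2) (hrec : ∀ i j : V, i ≠ j → a i j + a j i = y i * y j)

/-! ## §1. The even-block identity `p_{e_r} q_z + p_z q_{e_r} = q_{e_r} ⋆ f_o` -/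

/-- `(q_{e_r} ⋆ Y)(C) = adj(L_C + D_y)_{rr}` for `r ∈ C` (the principal cofactor as a rooted forest sum). [cite: ChebotarevAgaev2002, §3 Thm. 2] [cite: Chaiken1982, §2] -/
theorem sconv_qwt_single_setExp_eq_adjugate {C : Finset V} {r : V} (hr : r ∈ C) :
    sconv (qwt a (Pi.single r 1)) (setExp (qwt a y)) C = (lap a C y).adjugate r r := by
  rw [adjugate_lap_self_eq_sum a y hr, sconv_apply]
  have h : ∀ X ∈ C.powerset, qwt a (Pi.single r 1) X * setExp (qwt a y) (C \ X) =
      if r ∈ X then treeDet a X r * setExp (qwt a y) (C \ X) else 0 := by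
    intro X _; rw [qwt_single]; split_ifs <;> simp
  rw [sum_congr rfl h, ← sum_filter, sum_powerset_filter_mem_eq _ hr]
  exact sum_congr rfl fun E _ => by rw [erase_sdiff_eq_sdiff_insert]

/-- `((p_z q_{e_r}) ⋆ Y)(C)` is the tree's pinned sum at `r` with root weights `z`. [cite: Chaiken1982, §2] [cite: Smith2016CongruentDensity, §2.2 case 5(b)] -/
theorem sconv_spoint_qwt_single_setExp_eq_pinned {C : Finset V} {r : V} (hr : r ∈ C) :
    sconv (spoint z (qwt a (Pi.single r 1))) (setExp (qwt a y)) C =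
      ∑ E ∈ (C.erase r).powerset, (∑ i ∈ insert r E, z i) * treeDet a (insert r E) r * setExp (qwt a y) (C.erase r \ E) := by
  rw [sconv_apply]
  have h : ∀ X ∈ C.powerset, spoint z (qwt a (Pi.single r 1)) X * setExp (qwt a y) (C \ X) =
      if r ∈ X then (∑ i ∈ X, z i) * treeDet a X r * setExp (qwt a y) (C \ X) else 0 := by
    intro X _; rw [spoint_apply, qwt_single]; split_ifs <;> simp
  rw [sum_congr rfl h, ← sum_filter, sum_powerset_filter_mem_eq _ hr]
  exact sum_congr rfl fun E _ => by rw [erase_sdiff_eq_sdiff_insert]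

include hrec in
/-- **THE EVEN-BLOCK IDENTITY**: on an even block `C` (`Σ_C y = 0`), `(p_{e_r} q_z)(C) + (p_z q_{e_r})(C) = (q_{e_r} ⋆ f_o)(C)`, i.e.
`[r ∈ C]·(q_z(C) + (Σ_C z) κ_r(C)) = Σ_{r ∈ X ⊆ C} κ_r(X) f_o(C∖X)` — Leibniz with `f_o = p_z Y`, the pinned expansion
`((p_z q_{e_r}) ⋆ Y)(C) = q_z(C) + (Σ_C z) q_y(C)` and `(q_{e_r} ⋆ Y)(C) = adj(L_C+D_y)_{rr} = κ_r(C) + q_y(C)`.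
[cite: Smith2016CongruentDensity, §2.2 case 5(b)] [cite: Chaiken1982, §2] [cite: ChebotarevAgaev2002, §3 Thm. 2] -/
theorem even_block_identity {C : Finset V} (hyC : ∑ i ∈ C, y i = 0) (r : V) :
    spoint (Pi.single r 1) (qwt a z) C + spoint z (qwt a (Pi.single r 1)) C = sconv (qwt a (Pi.single r 1)) (fwt a y z 0) C := by
  have hrecC : ∀ i ∈ C, ∀ j ∈ C, i ≠ j → a i j + a j i = y i * y j := fun i _ j _ hij => hrec i j hij
  by_cases hr : r ∈ C
  · rw [← spoint_setExp_qwt_eq_fwt_zero_root a y z hrec, ← add_right_cancel_iff (a := sconv (spoint z (qwt a (Pi.single r 1))) (setExp (qwt a y)) C),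
      show sconv (qwt a (Pi.single r 1)) (spoint z (setExp (qwt a y))) C + sconv (spoint z (qwt a (Pi.single r 1))) (setExp (qwt a y)) C =
        spoint z (sconv (qwt a (Pi.single r 1)) (setExp (qwt a y))) C by rw [spoint_sconv, Pi.add_apply, add_comm],
      spoint_apply z (sconv _ _) C, sconv_qwt_single_setExp_eq_adjugate a y hr, adjugate_lap_self_eq a y hrecC hyC hr,
      sconv_spoint_qwt_single_setExp_eq_pinned a y z hr, pinned_expansion_eq a y z hrecC hyC hr, spoint_apply, spoint_apply, qwt_single,
      if_pos hr, sum_pi_single', if_pos hr]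
    grind
  · rw [spoint_apply, spoint_apply, qwt_single, if_neg hr, sum_pi_single', if_neg hr, zero_mul, mul_zero, zero_add]
    symm
    refine sconv_eq_zero_of fun X hX => ?_
    rw [qwt_single, if_neg (fun h => hr (hX h)), zero_mul]

/-! ## §2. The Leibniz expansions -/

include hrec in
/-- **The even part of row (iii) expanded**: `(p_y((p_x q_z) ⋆ E)) ⋆ W′ = (p_x f_o) ⋆ Y ⋆ F + (p_x q_z) ⋆ (Y ⋆ F + F + Y ⋆ f_o ⋆ F)`.
[cite: Stanley1999EC2, Cor. 5.1.6] [cite: Chaiken1982, §2] -/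
theorem row_three_even_expand (x : V → ZMod 2) :
    sconv (spoint y (sconv (spoint x (qwt a z)) (setExp (qwt a (fun i => y i + z i))))) (setExp (fwt a y z 0)) =
      sconv (spoint x (fwt a y z 0)) (sconv (setExp (qwt a y)) (setExp (fwt a y z z))) +
        (sconv (spoint x (qwt a z)) (sconv (setExp (qwt a y)) (setExp (fwt a y z z))) + sconv (spoint x (qwt a z)) (setExp (fwt a y z z)) +
          sconv (spoint x (qwt a z)) (sconv (setExp (qwt a y)) (sconv (fwt a y z 0) (setExp (fwt a y z z))))) := by
  have h1 := sconv_setExp_qwt_add_zero_root a y z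
  have hpyq : spoint y (spoint x (qwt a z)) = spoint x (fwt a y z 0) := by rw [spoint_comm, spoint_qwt_eq_fwt_zero_root]
  -- `p_y E ⋆ W′ = Y ⋆ F + F + Y ⋆ f_o ⋆ F`
  have h2 : sconv (spoint y (setExp (qwt a (fun i => y i + z i)))) (setExp (fwt a y z 0)) =
      sconv (setExp (qwt a y)) (setExp (fwt a y z z)) + setExp (fwt a y z z) +
        sconv (setExp (qwt a y)) (sconv (fwt a y z 0) (setExp (fwt a y z z))) := by
    rw [setExp_qwt_add_eq_sconv, spoint_sconv, spoint_setExp_qwt_self a y hrec, spoint_setExp_qwt a y z]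
    simp only [sconv_add_left, sconv_assoc, sdelta_sconv, sconv_setExp_qwt_zero_root]
  rw [spoint_sconv, hpyq, sconv_add_left, sconv_assoc, sconv_assoc, h1, h2]
  simp only [sconv_add_right]

include hrec in
/-- **The odd part of row (iii) expanded**: `(p_z(q_x ⋆ Y)) ⋆ (f_o ⋆ F) = ((p_z q_x) ⋆ Y) ⋆ (f_o ⋆ F)` (`p_z Y = f_o` and `f_o ⋆ f_o = 0`).
[cite: Stanley1999EC2, Cor. 5.1.6] [cite: Smith2016CongruentDensity, §2.2 case 5(b)] -/
theorem row_three_odd_expand (x : V → ZMod 2) :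
    sconv (spoint z (sconv (qwt a x) (setExp (qwt a y)))) (sconv (fwt a y z 0) (setExp (fwt a y z z))) =
      sconv (sconv (spoint z (qwt a x)) (setExp (qwt a y))) (sconv (fwt a y z 0) (setExp (fwt a y z z))) := by
  have hfo : fwt a y z 0 ∅ = 0 := by rw [fwt_zero_root_apply, sum_empty, zero_mul]
  rw [spoint_sconv, spoint_setExp_qwt_eq_fwt_zero_root a y z hrec, sconv_add_left, sconv_assoc (qwt a x),
    ← sconv_assoc (fwt a y z 0) (fwt a y z 0), sconv_self_eq_zero hfo, zero_sconv, sconv_zero, add_zero]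

include hrec in
/-- **The `G`-part of the target**: `(Σ_D x)·(Y ⋆ F)(D) = ((p_y q_x) ⋆ F)(D) + (Y ⋆ (p_x f_e) ⋆ F)(D)` (Leibniz; pointed reciprocity `p_x Y = p_y q_x`).
[cite: Stanley1999EC2, Cor. 5.1.6] [cite: Smith2016CongruentDensity, §2.2 case 5(b)] -/
theorem row_three_target_expand (x : V → ZMod 2) (D : Finset V) :
    (∑ i ∈ D, x i) * sconv (setExp (qwt a y)) (setExp (fwt a y z z)) D =
      sconv (spoint y (qwt a x)) (setExp (fwt a y z z)) D +
        sconv (setExp (qwt a y)) (sconv (spoint x (fwt a y z z)) (setExp (fwt a y z z))) D := by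
  rw [← spoint_apply x (sconv _ _) D, spoint_sconv, spoint_setExp_qwt_eq a y hrec x, spoint_setExp, Pi.add_apply]

/-! ## §3. The residual term vanishes -/

include hrec in
/-- **`(((p_x q_z) + (p_z q_x)) ⋆ Y ⋆ f_o ⋆ F)(D) = 0`** for `x = e_r` and `Σ_D y = 1`: write `Y = p_y Y + δ`; against `(p_y Y) ⋆ f_o ⋆ F` (even
support) the first block is odd and `p_x q_z = p_z q_x` there (flatness); against `f_o ⋆ F` (odd support) it is even and carries `q_x ⋆ f_o`
(`even_block_identity`), and `f_o ⋆ f_o = 0`. [cite: Smith2016CongruentDensity, §2.2 case 5(b)] [cite: Chaiken1982, §2] -/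
theorem row_three_residual_eq_zero {D : Finset V} (hyD : ∑ i ∈ D, y i = 1) (r : V) :
    sconv (spoint (Pi.single r 1) (qwt a z) + spoint z (qwt a (Pi.single r 1)))
      (sconv (setExp (qwt a y)) (sconv (fwt a y z 0) (setExp (fwt a y z z)))) D = 0 := by
  -- `Y = p_y Y + δ`
  have hY : setExp (qwt a y) = spoint y (setExp (qwt a y)) + sdelta := by
    rw [spoint_setExp_qwt_self a y hrec, add_assoc, add_self_weight, add_zero]
  have hsplit : ∀ A, A ⊆ D → ∑ i ∈ D, y i = ∑ i ∈ A, y i + ∑ i ∈ D \ A, y i := by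
    intro A hA; rw [← sum_union disjoint_sdiff, union_sdiff_of_subset hA]
  rw [hY, sconv_add_left (spoint y (setExp (qwt a y))) sdelta, sdelta_sconv, sconv_add_right, Pi.add_apply]
  have hodd : ∀ X, fwt a y z 0 X ≠ 0 → ∑ i ∈ X, y i = 1 := fwt_zero_root_support_odd a y z
  have heven : ∀ X, setExp (fwt a y z z) X ≠ 0 → ∑ i ∈ X, y i = 0 := setExp_fwt_self_support_even a y z hrec
  -- first part: the pointed block is odd
  have h1 : sconv (spoint (Pi.single r 1) (qwt a z) + spoint z (qwt a (Pi.single r 1)))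
      (sconv (spoint y (setExp (qwt a y))) (sconv (fwt a y z 0) (setExp (fwt a y z z)))) D = 0 := by
    refine sconv_eq_zero_of fun A hA => ?_
    by_cases hG : sconv (spoint y (setExp (qwt a y))) (sconv (fwt a y z 0) (setExp (fwt a y z z))) (D \ A) = 0
    · rw [hG, mul_zero]
    have hpar := sconv_support_parity y (spoint_support_odd y _) (sconv_support_parity y hodd heven) _ hG
    have hA1 : ∑ i ∈ A, y i = 1 := by
      have e : ∀ u : ZMod 2, 1 = u + (1 + (1 + 0)) → u = 1 := by decide
      have h := hsplit A hA
      rw [hyD, hpar] at h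
      exact e _ h
    rw [Pi.add_apply, spoint_qwt_symm_of_odd a y hrec (Pi.single r 1) z hA1, CharTwo.add_self_eq_zero, zero_mul]
  -- second part: the pointed block is even, carries `q_x ⋆ f_o`, and `f_o ⋆ f_o = 0`
  have h2 : sconv (spoint (Pi.single r 1) (qwt a z) + spoint z (qwt a (Pi.single r 1)))
      (sconv (fwt a y z 0) (setExp (fwt a y z z))) D =
      sconv (sconv (qwt a (Pi.single r 1)) (fwt a y z 0)) (sconv (fwt a y z 0) (setExp (fwt a y z z))) D := by
    refine sconv_congr_left fun A hA hG => ?_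
    have hpar := sconv_support_parity y hodd heven _ hG
    have hA0 : ∑ i ∈ A, y i = 0 := by
      have e : ∀ u : ZMod 2, 1 = u + (1 + 0) → u = 0 := by decide
      have h := hsplit A hA
      rw [hyD, hpar] at h
      exact e _ h
    rw [Pi.add_apply, even_block_identity a y z hrec hA0 r]
  have hfo : fwt a y z 0 ∅ = 0 := by rw [fwt_zero_root_apply, sum_empty, zero_mul]
  rw [h1, h2, sconv_assoc, ← sconv_assoc (fwt a y z 0) (fwt a y z 0), sconv_self_eq_zero hfo, zero_sconv, sconv_zero, zero_add,
    Pi.zero_apply]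

/-! ## §4. Row (iii) -/

include hrec in
/-- **ROW (iii) OF THE EVEN Ω-IDENTITY, ABSTRACT FORM** (value at a unit vector `x = e_r`; `Σ_D y = 1`):
`((p_y((p_x q_z) ⋆ setExp(q_{y+z}))) ⋆ setExp(fwt a y z 0))(D) + ((p_z(q_x ⋆ setExp(q_y))) ⋆ (fwt a y z 0 ⋆ setExp(fwt a y z z)))(D)
= ((p_y q_x) ⋆ F)(D) + ((p_x q_z) ⋆ F)(D) + (Σ_D x)·(setExp(q_y) ⋆ F)(D)`, `F = setExp(fwt a y z z)`.  For Monsky's data the left side is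
`Σ_{S∋r} w_S κ^S_r + Σ_{T∋r} c_T ρ^T_r` and the right side is `A_r + A′_r + G` (`Lines/offtyz_v7_EvenOmegaProof.md` §1, §6).
[cite: Chaiken1982, §2] [cite: Stanley1999EC2, Cor. 5.1.6] [cite: Smith2016CongruentDensity, §2.2 case 5(b)]
[cite: HeathBrown1994SelmerCongruentII, Appendix (Monsky), typescript p. 41 L20–L36] -/
theorem row_three_identity {D : Finset V} (hyD : ∑ i ∈ D, y i = 1) (r : V) :
    sconv (spoint y (sconv (spoint (Pi.single r 1) (qwt a z)) (setExp (qwt a (fun i => y i + z i))))) (setExp (fwt a y z 0)) D +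
      sconv (spoint z (sconv (qwt a (Pi.single r 1)) (setExp (qwt a y)))) (sconv (fwt a y z 0) (setExp (fwt a y z z))) D =
      sconv (spoint y (qwt a (Pi.single r 1))) (setExp (fwt a y z z)) D +
        sconv (spoint (Pi.single r 1) (qwt a z)) (setExp (fwt a y z z)) D +
        (∑ i ∈ D, (Pi.single r (1 : ZMod 2) : V → ZMod 2) i) * sconv (setExp (qwt a y)) (setExp (fwt a y z z)) D := by
  rw [row_three_even_expand a y z hrec, row_three_odd_expand a y z hrec, row_three_target_expand a y z hrec]
  simp only [Pi.add_apply]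
  have hres := row_three_residual_eq_zero a y z hrec hyD r
  rw [sconv_add_left, Pi.add_apply, ← sconv_assoc (spoint z (qwt a (Pi.single r 1)))] at hres
  -- `(p_x f_o) ⋆ Y ⋆ F + (p_x q_z) ⋆ Y ⋆ F = (p_x f_e) ⋆ Y ⋆ F = Y ⋆ (p_x f_e) ⋆ F`
  have hcomb : sconv (spoint (Pi.single r (1 : ZMod 2)) (fwt a y z 0)) (sconv (setExp (qwt a y)) (setExp (fwt a y z z))) D +
      sconv (spoint (Pi.single r 1) (qwt a z)) (sconv (setExp (qwt a y)) (setExp (fwt a y z z))) D =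
      sconv (setExp (qwt a y)) (sconv (spoint (Pi.single r 1) (fwt a y z z)) (setExp (fwt a y z z))) D := by
    rw [← Pi.add_apply (sconv _ _) (sconv _ _) D, ← sconv_add_left, ← spoint_add, fwt_zero_root_add_qwt a y z, sconv_left_comm]
  grind

end RowThree

end Summit.BirchSwinnertonDyer.PrintCf2.QFormForest
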